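import Summits.PneNP.PneNP.Theorems.SoloBlindStreamingOracle
import HarnessLib

/-!
# THEOREM B: McKay–Murray–Williams Theorem 1.3 without the named fact, for size bounds computed on codes

McKay, Murray and Williams [MMW19, Theorem 1.3] prove: if there is a time-constructible `s` such
that `MCSP[s(n)]` has no `poly(s(n))`-space streaming algorithm with `poly(s(n))` update time,
then `P ≠ NP`.  The tree records this as the *named fact* `thm13` over the uniform streaming
class `USTREAM` (update and report time `s(log N)^c + c`).  THEOREM A of
`SoloBlindFactFreeMagnification` proved the weaker magnification statement with update time
`N^c + c` from first principles.  This file closes the gap: for every size bound `s` with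
`n ≤ s n` that is computed on codes from unary inputs (`CodeFP unE natE s`; this covers
`n ↦ n^k`, `n ↦ 2^{⌊εn⌋}`, and every bound given by an `FP` function on `1ⁿ`),

* `MCSPSize_mem_USTREAM_poly_of_P_eq_NP`: `P = NP → ∃ c, MCSP[s] ∈ USTREAM (s(log N)^c + c) (s(log N)^c + c)`;
* `thm13_codeFP`: the statement of `thm13` with `IsTimeConstructible s` replaced by
  `(∀ n, n ≤ s n) ∧ CodeFP unE natE s` is a theorem of the tree (kernel-checked, no named fact);
* `pneNP_of_streamingLowerBound_codeFP`: `StreamingLowerBound s → PneNP` for such `s`;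
* `pneNP_of_streamingLowerBound_pow`: in particular for `s n = n^k`, `k ≥ 1`.

## Proof

The algorithm is the consistent-program streaming algorithm of Layer 1
(`SoloBlindConsistentStreaming`), whose state after `j` bits of an input of length `N = 2ⁿ` is
`⟨j, alive, D⟩` with `D` a program of a circuit of size `≤ s n` consistent with the prefix.  Two
changes to the proof of THEOREM A make the update time polynomial in `s n` rather than in `N`:

1. *No replay.*  THEOREM A checked consistency of a candidate successor `D'` with the current
   program `D` on all earlier rows `t < j` by evaluating both circuits on every row (time
   `poly(N)`).  Here the disagreement language
   `BAD = {⟨1ⁿ, N, j, D, D'⟩ : ∃ t < j, t < N, D'(t) ≠ D(t)}` is in `NP` (certificate: `t` in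
   binary), hence in `P` under the standing assumption `NP ⊆ P`; its indicator is then a
   polynomial-time *disagreement oracle* (`exists_goodTest`), and the goodness test calls it once.
2. *Short padding.*  The `NP ⊆ P` search-to-decision selector needs witnesses (`D'`, of length
   `≤ K = (s n + 1)(8(n + s n) + 10)`) polynomially bounded in the instance length; THEOREM A padded
   the instance with `1^N`, here we pad with `1^(s n + 1)` (`exists_selectorG`, witness polynomial
   `4 (X + 1)²`).  The update machine (`exists_updateMachineG`) first computes `m = s n + 1` from
   `N` (this is where `CodeFP unE natE s` is used), then runs the `while` combinator of
   `TM2While` for `m` rounds over the loop words `⟨flag, 1^i, m, u⟩` to produce the padding, then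
   the padded update on codes; its running time is `q(s n + |bin N| + |σ|)` for a fixed polynomial
   `q`, and `|σ| ≤ 16 (s n)² + 28 s n + 15`, `|bin N| ≤ n + 1 ≤ s n + 1`.

Everything is stated for a *generic goodness test* `G` (`GTest`, `updateG`, `cf_updateG`), and the
update machine and the assembly are further abstracted over the machine's first stage
(`exists_updateMachine_of_init`, `mem_USTREAM_poly_of_parts`), so that the time-constructible
version (THEOREM C, `SoloBlindTimeConstructible`, where the first stage runs the
time-constructibility machine of `s` instead of a code stage) shares them verbatim.

References: D. M. McKay, C. D. Murray, R. R. Williams, *Weak lower bounds on resource-bounded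
compression imply strong separations of complexity classes*, STOC 2019, Theorem 1.3 and §2;
S. Arora, B. Barak, *Computational Complexity: A Modern Approach*, 2009, §1.3–1.4, Thm. 2.18
(search-to-decision for `NP` under `P = NP`).
-/

namespace Summit.PneNP.PneNP.Theorems.SoloBlind

open Computability Polynomial
open Literature.Computability.Complexity Literature.Computability.Complexity.CircEval
open Literature.Computability.Complexity.CodeFP (natE unE bitE pairE rawE strE unitE pairE_apply
  unE_eq_ones length_unE length_natE_le)
open Literature.Computability.MetaComplexity Literature.Computability.MetaComplexity.MCSPVerif
open Literature.Computability.MetaComplexity.McKayMurrayWilliams2019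

namespace CStream

/-! ### The update machine with short padding -/

/-- **The update machine, generic in its first stage.** If some machine writes the initial loop
word `⟨ff, 1⁰, s (log N) + 1, u⟩` from the update input `u = ⟨N, ⟨σ, b⟩⟩` within
`p₁(s (log N) + |bin N| + |σ|)` steps, then for every goodness test computed on codes and every
`g ∈ FP` there is a TM2 machine computing `σ, b ↦ updateG G g (s (log N) + 1) N σ b` on `u` within
`q(s (log N) + |bin N| + |σ|)` steps, for a fixed polynomial `q`: run the `while` combinator of
`TM2While` for `s (log N) + 1` rounds over the loop words, then the padded update on codes.
[cite: AroraBarak2009, §1.3–1.4 (composition of machines; running a machine in a loop)] -/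
theorem exists_updateMachine_of_init {s : ℕ → ℕ} {G : GTest}
    (hGc : CodeFP (pairE instE strE) bitE
      (fun q => G q.1.1 q.1.2.1 q.1.2.2.1 q.1.2.2.2.1 q.1.2.2.2.2 q.2))
    {g : List Bool → List Bool} (hg : g ∈ FP)
    (hinit : ∃ (M₁ : Turing.TM2ComputableAux Bool Bool) (p₁ : Polynomial ℕ),
      ∀ (N : ℕ) (σ : List Bool) (b : Bool), M₁.OutputsWithin (uE (N, σ, b))
        (orbitB (s (Nat.log 2 N) + 1) (N, σ, b) 0)
        (p₁.eval (s (Nat.log 2 N) + (natE N).length + σ.length))) :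
    ∃ (M : Turing.TM2ComputableAux Bool Bool) (q : Polynomial ℕ),
      ∀ (N : ℕ) (σ : List Bool) (b : Bool),
        M.OutputsWithin (boolPair (encodeNat N) (boolPair σ [b]))
          (updateG G g (s (Nat.log 2 N) + 1) N σ b)
          (q.eval (s (Nat.log 2 N) + (natE N).length + σ.length)) := by
  obtain ⟨M₁, p₁, h₁⟩ := hinit
  obtain ⟨p₂, M₂, h₂⟩ := cf_padStepB.polyTimeComputable
  obtain ⟨p₃, M₃, h₃⟩ := (cf_padCoreB hGc hg).polyTimeComputable
  refine ⟨(M₁.comp (TM2While.whileAux M₂ fun a : Bool => a)).comp M₃,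
    (X * (p₂ + p₃ + 2 * X + 2)).comp (4 * X + 17) + p₁, fun N σ b => ?_⟩
  set n := s (Nat.log 2 N) with hn
  -- stage 1: write the loop word
  have H1 : M₁.OutputsWithin (uE (N, σ, b)) (orbitB (n + 1) (N, σ, b) 0)
      (p₁.eval (n + (natE N).length + σ.length)) := h₁ N σ b
  -- stage 2: the loop
  have hrun : ∀ i ≤ n, M₂.OutputsWithin (orbitB (n + 1) (N, σ, b) i)
      (orbitB (n + 1) (N, σ, b) (i + 1))
      (p₂.eval (orbitB (n + 1) (N, σ, b) i).length) :=
    fun i _ => h₂ (flB (n + 1) i, i, n + 1, (N, σ, b))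
  have hgo : ∀ i < n, ∃ a rest, orbitB (n + 1) (N, σ, b) (i + 1) = a :: rest ∧
      (fun a : Bool => a) a = false :=
    fun i hi => ⟨_, _, orbitB_eq_cons _ _ (i + 1), by simp [flB]; omega⟩
  have hstop : ∃ a rest, orbitB (n + 1) (N, σ, b) (n + 1) = a :: rest ∧ (fun a : Bool => a) a = true :=
    ⟨_, _, orbitB_eq_cons _ _ (n + 1), by simp [flB]⟩
  have H2 := TM2While.whileAux_outputsWithin M₂ (fun a : Bool => a) n (orbitB (n + 1) (N, σ, b))
    (fun i => p₂.eval (orbitB (n + 1) (N, σ, b) i).length) hrun hgo hstop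
  -- stage 3: the core
  have H3 : M₃.OutputsWithin (orbitB (n + 1) (N, σ, b) (n + 1)) (updateG G g (n + 1) N σ b)
      (p₃.eval (orbitB (n + 1) (N, σ, b) (n + 1)).length) :=
    h₃ (flB (n + 1) (n + 1), n + 1, n + 1, (N, σ, b))
  have H := Turing.TM2ComputableAux.comp_outputsWithin _ _
    (Turing.TM2ComputableAux.comp_outputsWithin _ _ H1 H2) H3
  refine H.mono ?_
  -- the time bound
  set A := n + (natE N).length + σ.length with hA
  set L := (uE (N, σ, b)).length with hL
  set Lw := 2 * (n + 1) + 2 * (natE (n + 1)).length + 8 + L with hLw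
  have hol : ∀ i ≤ n + 1, (orbitB (n + 1) (N, σ, b) i).length ≤ Lw := fun i hi => by
    rw [length_orbitB]; omega
  have hsum : ∑ i ∈ Finset.range (n + 1), (p₂.eval (orbitB (n + 1) (N, σ, b) i).length
      + 2 * (orbitB (n + 1) (N, σ, b) (i + 1)).length + 2) ≤ (n + 1) * (p₂.eval Lw + 2 * Lw + 2) := by
    have h := Finset.sum_le_card_nsmul (Finset.range (n + 1))
      (fun i => p₂.eval (orbitB (n + 1) (N, σ, b) i).length
        + 2 * (orbitB (n + 1) (N, σ, b) (i + 1)).length + 2) (p₂.eval Lw + 2 * Lw + 2)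
      (fun i hi => by
        rw [Finset.mem_range] at hi
        have ho1 := TM2Iter.eval_mono p₂ (hol i (by omega))
        have ho2 := hol (i + 1) (by omega)
        omega)
    simpa using h
  have hp3 : p₃.eval (orbitB (n + 1) (N, σ, b) (n + 1)).length ≤ p₃.eval Lw :=
    TM2Iter.eval_mono p₃ (hol (n + 1) le_rfl)
  have hLw1 : n + 1 ≤ Lw := by omega
  have hq : (X * (p₂ + p₃ + 2 * X + 2) : Polynomial ℕ).eval Lw
      = Lw * (p₂.eval Lw + p₃.eval Lw + 2 * Lw + 2) := by
    simp [eval_mul, eval_add]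
  have hLσ : Lw ≤ 4 * A + 17 := by
    have := length_uE N σ b
    have := length_natE_le (n + 1)
    omega
  have hcomp : ((X * (p₂ + p₃ + 2 * X + 2)).comp (4 * X + 17) + p₁ : Polynomial ℕ).eval A
      = (X * (p₂ + p₃ + 2 * X + 2) : Polynomial ℕ).eval (4 * A + 17) + p₁.eval A := by
    simp [eval_comp, eval_mul, eval_add]
  rw [hcomp]
  refine le_trans ?_ (Nat.add_le_add_right (TM2Iter.eval_mono _ hLσ) _)
  rw [hq]
  have e1 : p₃.eval Lw ≤ Lw * p₃.eval Lw := Nat.le_mul_of_pos_left _ (by omega)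
  have e2 : (n + 1) * (p₂.eval Lw + 2 * Lw + 2) ≤ Lw * (p₂.eval Lw + 2 * Lw + 2) :=
    Nat.mul_le_mul_right _ hLw1
  calc p₃.eval (orbitB (n + 1) (N, σ, b) (n + 1)).length
        + (∑ i ∈ Finset.range (n + 1), (p₂.eval (orbitB (n + 1) (N, σ, b) i).length
            + 2 * (orbitB (n + 1) (N, σ, b) (i + 1)).length + 2) + p₁.eval A)
      ≤ p₃.eval Lw + ((n + 1) * (p₂.eval Lw + 2 * Lw + 2) + p₁.eval A) := by
        gcongr
    _ ≤ Lw * p₃.eval Lw + (Lw * (p₂.eval Lw + 2 * Lw + 2) + p₁.eval A) := by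
        gcongr
    _ = Lw * (p₂.eval Lw + p₃.eval Lw + 2 * Lw + 2) + p₁.eval A := by ring

/-- **The update machine with short padding.** For every size bound computed on codes, every
goodness test computed on codes and every `g ∈ FP` there is a TM2 machine computing
`σ, b ↦ updateG G g (s (log N) + 1) N σ b` on the update input `⟨N, ⟨σ, b⟩⟩` within
`q(s (log N) + |bin N| + |σ|)` steps, for a fixed polynomial `q` (the first stage computes
`s (log N) + 1` on codes). [cite: AroraBarak2009, §1.3–1.4] -/
theorem exists_updateMachineG {s : ℕ → ℕ} (hsC : CodeFP unE natE s) {G : GTest}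
    (hGc : CodeFP (pairE instE strE) bitE
      (fun q => G q.1.1 q.1.2.1 q.1.2.2.1 q.1.2.2.2.1 q.1.2.2.2.2 q.2))
    {g : List Bool → List Bool} (hg : g ∈ FP) :
    ∃ (M : Turing.TM2ComputableAux Bool Bool) (q : Polynomial ℕ),
      ∀ (N : ℕ) (σ : List Bool) (b : Bool),
        M.OutputsWithin (boolPair (encodeNat N) (boolPair σ [b]))
          (updateG G g (s (Nat.log 2 N) + 1) N σ b)
          (q.eval (s (Nat.log 2 N) + (natE N).length + σ.length)) := by
  refine exists_updateMachine_of_init hGc hg ?_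
  obtain ⟨p, M₁, h₁⟩ := (cf_padInitB hsC).polyTimeComputable
  refine ⟨M₁, p.comp (2 * X + 5), fun N σ b => (h₁ (N, σ, b)).mono ?_⟩
  have e : (p.comp (2 * X + 5) : Polynomial ℕ).eval (s (Nat.log 2 N) + (natE N).length + σ.length)
      = p.eval (2 * (s (Nat.log 2 N) + (natE N).length + σ.length) + 5) := by
    simp [eval_comp, eval_mul, eval_add]
  rw [e]
  exact TM2Iter.eval_mono p (by rw [length_uE]; omega)

/-! ### Assembly: `MCSP[s] ∈ USTREAM (poly s) (poly s)` under `NP ⊆ P` -/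

/-- **Assembly from parts.** If a goodness test `G` agrees with `Good s` at padding
`s (log N) + 1`, the selector induced by `g` at that padding returns good successor programs
whenever one exists, and some machine computes `updateG G g (s (log N) + 1) N` on update inputs
within `q(s (log N) + |bin N| + |σ|)` steps, then for some `c` the language `MCSP[s]` is decided by
a uniform one-pass streaming algorithm with `s(log N)^c + c` space and `s(log N)^c + c` update and
report time (the consistent-program algorithm of Layer 1 with selector `selAt g`).
[cite: McKayMurrayWilliams2019, Thm. 1.3 (contrapositive direction of the proof)] -/
theorem mem_USTREAM_poly_of_parts {s : ℕ → ℕ} (hs : ∀ n, n ≤ s n) {G : GTest}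
    {g : List Bool → List Bool}
    (hG1 : ∀ N j D b D', G (s (Nat.log 2 N) + 1) N j D b D' = Good s N j D b D')
    (hsel : ∀ N j D b D₀, Good s N j D b D₀ = true →
      Good s N j D b (selAt g (fun N => s (Nat.log 2 N) + 1) N j D b) = true)
    (hM : ∃ (Mu : Turing.TM2ComputableAux Bool Bool) (q : Polynomial ℕ),
      ∀ (N : ℕ) (σ : List Bool) (b : Bool),
        Mu.OutputsWithin (boolPair (encodeNat N) (boolPair σ [b]))
          (updateG G g (s (Nat.log 2 N) + 1) N σ b)
          (q.eval (s (Nat.log 2 N) + (natE N).length + σ.length))) :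
    ∃ c : ℕ, MCSPSize s ∈ USTREAM (fun N => s (Nat.log 2 N) ^ c + c)
      (fun N => s (Nat.log 2 N) ^ c + c) := by
  obtain ⟨Mu, q, hMu⟩ := hM
  obtain ⟨p₄, M₄, h₄⟩ := cf_accept.polyTimeComputable
  set sel : Sel := selAt g (fun N => s (Nat.log 2 N) + 1) with hsel_def
  have hSpace : RunsInSpace (alg s sel) (fun N => 2 * N.size + K s (Nat.log 2 N) + 3) :=
    alg_runsInSpace s sel
  -- membership with the raw bounds
  have hmem : MCSPSize s ∈ USTREAM (fun N => 2 * N.size + K s (Nat.log 2 N) + 3)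
      (fun N => q.eval (s (Nat.log 2 N) + N.size + (2 * N.size + K s (Nat.log 2 N) + 3))
        + p₄.eval (2 * N.size + 2 + (2 * N.size + K s (Nat.log 2 N) + 3))) := by
    refine ⟨alg s sel, alg_init s sel, hSpace, ⟨Mu, fun N x b hx => ?_⟩,
      ⟨M₄, fun x => ?_⟩, alg_decides s sel hs hsel⟩
    · have hσ : (reach (alg s sel) N x).length ≤ 2 * N.size + K s (Nat.log 2 N) + 3 :=
        hSpace N x hx.le
      have h := hMu N (reach (alg s sel) N x) b
      rw [reach_append_singleton, alg_update, hsel_def,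
        ← updateG_eq s (P := fun N => s (Nat.log 2 N) + 1) hG1]
      have hsz : (natE N).length = N.size := TM2Pass.length_encodeNat_eq_size N
      exact h.mono ((TM2Iter.eval_mono q (by omega)).trans (Nat.le_add_right _ _))
    · have hσ : ((alg s sel).finalState x).length
          ≤ 2 * x.length.size + K s (Nat.log 2 x.length) + 3 := by
        rw [finalState_eq_reach]; exact hSpace _ x le_rfl
      have h := h₄ (x.length, (alg s sel).finalState x)
      have hin : (pairE natE strE (x.length, (alg s sel).finalState x)).length
          ≤ 2 * x.length.size + 2 + (2 * x.length.size + K s (Nat.log 2 x.length) + 3) := by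
        show (boolPair (natE x.length) ((alg s sel).finalState x)).length ≤ _
        rw [length_boolPair]
        have := TM2Pass.length_encodeNat_eq_size x.length
        have : (natE x.length).length = x.length.size := this
        omega
      exact h.mono ((TM2Iter.eval_mono p₄ hin).trans (Nat.le_add_left _ _))
  -- polynomial bounds in `s (log N)`
  have hsz : ∀ N : ℕ, N.size ≤ s (Nat.log 2 N) + 1 := fun N =>
    (Nat.size_le.2 (Nat.lt_pow_succ_log_self one_lt_two N)).trans
      (Nat.succ_le_succ (hs _))
  obtain ⟨c₁, hc₁⟩ := exists_eval_le_pow_add_self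
    (q.comp (X + (X + 1) + (X ^ 61 + 61)) + p₄.comp (2 * (X + 1) + 2 + (X ^ 61 + 61)))
  have hT : ∀ N, q.eval (s (Nat.log 2 N) + N.size + (2 * N.size + K s (Nat.log 2 N) + 3))
      + p₄.eval (2 * N.size + 2 + (2 * N.size + K s (Nat.log 2 N) + 3))
        ≤ s (Nat.log 2 N) ^ (c₁ + 61) + (c₁ + 61) := fun N => by
    refine le_trans ?_ ((hc₁ (s (Nat.log 2 N))).trans
      (pow_add_self_mono _ (Nat.le_add_right c₁ 61)))
    have e : (q.comp (X + (X + 1) + (X ^ 61 + 61)) + p₄.comp (2 * (X + 1) + 2 + (X ^ 61 + 61)) :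
        Polynomial ℕ).eval (s (Nat.log 2 N))
          = q.eval (s (Nat.log 2 N) + (s (Nat.log 2 N) + 1) + (s (Nat.log 2 N) ^ 61 + 61))
            + p₄.eval (2 * (s (Nat.log 2 N) + 1) + 2 + (s (Nat.log 2 N) ^ 61 + 61)) := by
      simp [eval_comp, eval_pow]
    rw [e]
    have hS := space_le_pow hs N
    have hz := hsz N
    exact Nat.add_le_add (TM2Iter.eval_mono q (by omega)) (TM2Iter.eval_mono p₄ (by omega))
  have hS : ∀ N, 2 * N.size + K s (Nat.log 2 N) + 3 ≤ s (Nat.log 2 N) ^ (c₁ + 61) + (c₁ + 61) :=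
    fun N => (space_le_pow hs N).trans (pow_add_self_mono _ (Nat.le_add_left 61 c₁))
  exact ⟨c₁ + 61, USTREAM_mono hS hT hmem⟩

/-- **Uniform streaming upper bound for `MCSP[s]` under `NP ⊆ P`, with `poly(s)` update time.**
If `NP ⊆ P`, `n ≤ s n` and `s` is computed on codes from unary inputs, then for some `c` the
language `MCSP[s]` is decided by a uniform one-pass streaming algorithm with `s(log N)^c + c`
space and `s(log N)^c + c` update and report time.
[cite: McKayMurrayWilliams2019, Thm. 1.3 (contrapositive direction of the proof)] -/
theorem mem_USTREAM_poly_of_NP_subset_P {s : ℕ → ℕ} (hNP : Nondeterministic.NP ⊆ Classes.P)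
    (hs : ∀ n, n ≤ s n) (hsC : CodeFP unE natE s) :
    ∃ c : ℕ, MCSPSize s ∈ USTREAM (fun N => s (Nat.log 2 N) ^ c + c)
      (fun N => s (Nat.log 2 N) ^ c + c) := by
  obtain ⟨G, hGc, hGeq⟩ := exists_goodTest hNP hsC
  obtain ⟨g, hg, hsel⟩ := exists_selectorG hNP hs hGc hGeq (P := fun N => s (Nat.log 2 N) + 1)
    (fun N => Nat.le_succ _)
  exact mem_USTREAM_poly_of_parts hs (fun N j D b D' => hGeq _ N j D b D') hsel
    (exists_updateMachineG hsC hGc hg)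

end CStream

/-! ### THEOREM B -/

/-- **`P = NP` puts `MCSP[s]` into `USTREAM (poly s) (poly s)`.** If `P = NP`, then for every
size bound `s` with `n ≤ s n` that is computed on codes from unary inputs there is a `c` with
`MCSP[s] ∈ USTREAM (s(log N)^c + c) (s(log N)^c + c)`.
[cite: McKayMurrayWilliams2019, Thm. 1.3 (proof)] -/
theorem MCSPSize_mem_USTREAM_poly_of_P_eq_NP (h : Classes.P = Nondeterministic.NP) {s : ℕ → ℕ}
    (hs : ∀ n, n ≤ s n) (hsC : CodeFP unE natE s) :
    ∃ c : ℕ, MCSPSize s ∈ USTREAM (fun N => s (Nat.log 2 N) ^ c + c)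
      (fun N => s (Nat.log 2 N) ^ c + c) :=
  CStream.mem_USTREAM_poly_of_NP_subset_P (fun L hL => by rw [h]; exact hL) hs hsC

/-- Under `P = NP` the streaming lower bound fails for every such `s`. [cite: McKayMurrayWilliams2019, Thm. 1.3] -/
theorem not_streamingLowerBound_of_P_eq_NP (h : Classes.P = Nondeterministic.NP) {s : ℕ → ℕ}
    (hs : ∀ n, n ≤ s n) (hsC : CodeFP unE natE s) : ¬ StreamingLowerBound s := fun hlb => by
  obtain ⟨c, hc⟩ := MCSPSize_mem_USTREAM_poly_of_P_eq_NP h hs hsC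
  exact hlb c hc

/-- **THEOREM B (McKay–Murray–Williams Theorem 1.3, kernel-checked for size bounds computed on
codes).** For every `s` with `n ≤ s n` computed on codes from unary inputs: if for every `c`
the language `MCSP[s]` is not decided by a uniform one-pass streaming algorithm with
`s(log N)^c + c` space and `s(log N)^c + c` update/report time, then `P ≠ NP`.  This is the
tree's named fact `thm13` with its hypothesis `IsTimeConstructible s` replaced by
`CodeFP unE natE s`; no named fact is consumed. [cite: McKayMurrayWilliams2019, Thm. 1.3] -/
theorem thm13_codeFP : ∀ s : ℕ → ℕ, (∀ n, n ≤ s n) → CodeFP unE natE s → StreamingLowerBound s →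
    Classes.P ≠ Nondeterministic.NP :=
  fun _ hs hsC hlb h => not_streamingLowerBound_of_P_eq_NP h hs hsC hlb

/-- **THEOREM B, summit form.** `StreamingLowerBound s → PneNP` for every size bound `s` with
`n ≤ s n` computed on codes from unary inputs. [cite: McKayMurrayWilliams2019, Thm. 1.3] -/
theorem pneNP_of_streamingLowerBound_codeFP {s : ℕ → ℕ} (hs : ∀ n, n ≤ s n)
    (hsC : CodeFP unE natE s) (hlb : StreamingLowerBound s) : PneNP := by
  rw [pneNP_iff_P_ne_NP]
  exact thm13_codeFP s hs hsC hlb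

/-- The same with the computability hypothesis in the tree's `FP` vocabulary. [folklore] -/
theorem pneNP_of_streamingLowerBound_FP {s : ℕ → ℕ} (hs : ∀ n, n ≤ s n)
    (hsFP : ∃ f ∈ FP, ∀ n, f (ones n) = encodeNat (s n)) (hlb : StreamingLowerBound s) :
    PneNP := by
  obtain ⟨f, hf, hfs⟩ := hsFP
  exact pneNP_of_streamingLowerBound_codeFP hs
    ⟨f, hf, fun n => by rw [unE_eq_ones]; exact hfs n⟩ hlb

/-- **THEOREM B for polynomial size bounds.** For every `k ≥ 1`: if `MCSP[n^k]` has no uniform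
one-pass streaming algorithm with `(log N)^{kc} + c` space and update/report time (for any `c`),
then `P ≠ NP`. [cite: McKayMurrayWilliams2019, Thm. 1.3 and Thm. 1.1 (discussion)] -/
theorem pneNP_of_streamingLowerBound_pow {k : ℕ} (hk : 1 ≤ k)
    (hlb : StreamingLowerBound (fun n => n ^ k)) : PneNP :=
  pneNP_of_streamingLowerBound_codeFP (fun n => Nat.le_self_pow (by omega) n)
    ((CodeFP.natPow.comp (CodeFP.natOfUn.pair (CodeFP.const unE k))).congr fun _ => rfl) hlb

end Summit.PneNP.PneNP.Theorems.SoloBlind
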